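import Mathlib.GroupTheory.Nilpotent
import Mathlib.GroupTheory.QuotientGroup.Basic
import Literature.Topology.FourManifolds.GroupTrisections
import Literature.GroupTheory.CombinatorialGroupTheory.MagnusResidualNilpotence
import Summits.SmoothPoincare4.SmoothPoincare4.Theorems.WaldhausenPairs.Negative.LoadBearing
import HarnessLib

/-!
# Towards stub `stub_johnsonClosedGate` of line `nilpotent-genus-class` for crux
`CongruenceShadows.ShadowApproximation` (item stmt-SmoothPoincare4-14595): the residual is exactly the
UNIFORMITY of the level solutions

Line `nilpotent-genus-class` solves the approximation crux level by level in the lower central series: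
its stubs 1–3 produce, for a slot-normalised group trisection `K = (N₀, N₁, K₂)` of the trivial group, at
every level `c` a Goeritz element `x_c ∈ Stab N₀ ∩ Stab N₁` with `x_c(N₂)·γ_c = K₂·γ_c`
(`γ_c = (⊤).lowerCentralSeries c`), and its residual stub 4 (`stub_johnsonClosedGate`) must pass from
these LEVEL-WISE solutions to an honest isomorphism `Iso N K`. This helper file (pure group theory over
`GroupTrisections.lean` and Magnus' theorem, no definitions, no named facts) pins down what the residual
is:

* `iInf_sup_lowerCentralSeries_eq_self` — a normal subgroup `K ◁ S` with FREE quotient `S ⧸ K` is closed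
  in the pro-nilpotent topology: `⨅ c, (K ⊔ γ_c S) = K` (Magnus: free groups are residually nilpotent,
  `Literature/GroupTheory/CombinatorialGroupTheory/MagnusResidualNilpotence.lean`, transported to the
  quotient). This is where `IsGroupTrisection.free_quotient` enters the residual (Disproof §3: without
  it the junk triple `(N₀, N₁, N₂ ⊓ ker θ)` has all level solutions `x_c = id` yet is not isomorphic
  to `N`; indeed `N₂ ⊓ ker θ` is NOT closed: `⨅_c (J₂ ⊔ γ_c) ⊇ N₂ ≠ J₂`).
* `map_eq_of_forall_map_sup_lowerCentralSeries_eq` — hence ONE automorphism `x` solving EVERY level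
  (`(N₂ ⊔ γ_c).map x = K₂ ⊔ γ_c` for all `c`) already satisfies `x(N₂) = K₂` (both sides are closed);
* `iso_of_uniform_levelSolution` — so a UNIFORM level solution `x ∈ Stab N₀ ∩ Stab N₁` gives
  `TrisectionKernels.Iso N K` for a slot-normalised `K` (`K₀ = N₀`, `K₁ = N₁`).
* `levelSolution_mono` — level solutions descend (`γ_{c+1} ≤ γ_c`): the solution sets
  `Sol_c = x_c · G_c`, `G_c = Stab N₀ ∩ Stab N₁ ∩ Stab(N₂·γ_c)`, form a DECREASING tower of cosets of a
  decreasing chain of subgroups containing the trisection group `G_N = Stab N₀ ∩ Stab N₁ ∩ Stab N₂`.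

So `stub_johnsonClosedGate` is precisely the MITTAG-LEFFLER statement `⋂_c Sol_c ≠ ∅` for honest `K`
(equivalently: some `x_{c₀}` can be corrected inside `G_{c₀}` to all deeper levels at once) — the
pro-nilpotent closedness of the Goeritz orbit of `N₂` on the locus of group trisections of `{1}`; nothing
weaker than uniformity suffices, and uniformity is all that is missing.
-/

-- the prescribed namespace `Summit.<P>.<Sub>.…` duplicates `SmoothPoincare4` (P = Sub)
set_option linter.dupNamespace false

noncomputable section

open Literature.Topology.FourManifolds

namespace Summit.SmoothPoincare4.SmoothPoincare4.Theorems.ShadowApproximation.NilpotentGenusClass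

variable {G : Type*} [Group G]

/-- In a group isomorphic to a free group the lower central series has trivial intersection
(Magnus' residual nilpotence, transported along the isomorphism). [folklore] -/
theorem iInf_lowerCentralSeries_eq_bot_of_mulEquiv {ι : Type*} (e : FreeGroup ι ≃* G) :
    ⨅ k, (⊤ : Subgroup G).lowerCentralSeries k = ⊥ := by
  have key : ∀ k, (⊤ : Subgroup G).lowerCentralSeries k =
      ((⊤ : Subgroup (FreeGroup ι)).lowerCentralSeries k).map e.toMonoidHom := by
    intro k
    rw [Subgroup.map_lowerCentralSeries, ← MonoidHom.range_eq_map,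
      MonoidHom.range_eq_top.2 e.surjective]
  rw [eq_bot_iff]
  intro x hx
  rw [Subgroup.mem_iInf] at hx
  have hx' : e.symm x ∈ ⨅ k, (⊤ : Subgroup (FreeGroup ι)).lowerCentralSeries k := by
    rw [Subgroup.mem_iInf]
    intro k
    have hk := hx k
    rw [key k, Subgroup.mem_map] at hk
    obtain ⟨y, hy, hyx⟩ := hk
    have : e.symm x = y := by rw [← hyx]; simp
    rw [this]
    exact hy
  rw [Literature.GroupTheory.CombinatorialGroupTheory.freeGroup_iInf_lowerCentralSeries_eq_bot,
    Subgroup.mem_bot] at hx'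
  rw [Subgroup.mem_bot]
  simpa using congrArg e hx'

/-- **A normal subgroup with free quotient is closed in the pro-nilpotent topology**:
`⨅_c (K ⊔ γ_c S) = K` whenever `S ⧸ K` is free (of any rank). [folklore] -/
theorem iInf_sup_lowerCentralSeries_eq_self (K : Subgroup G) [K.Normal] {n : ℕ}
    (hK : IsFreeOfRank (G ⧸ K) n) :
    ⨅ c, (K ⊔ (⊤ : Subgroup G).lowerCentralSeries c) = K := by
  obtain ⟨e⟩ := hK
  apply le_antisymm
  · intro x hx
    rw [Subgroup.mem_iInf] at hx
    have hq : (QuotientGroup.mk' K x) ∈ ⨅ c, (⊤ : Subgroup (G ⧸ K)).lowerCentralSeries c := by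
      rw [Subgroup.mem_iInf]
      intro c
      have h1 : QuotientGroup.mk' K x ∈ (K ⊔ (⊤ : Subgroup G).lowerCentralSeries c).map
          (QuotientGroup.mk' K) := Subgroup.mem_map_of_mem _ (hx c)
      rw [Subgroup.map_sup, QuotientGroup.map_mk'_self, bot_sup_eq, Subgroup.map_lowerCentralSeries,
        ← MonoidHom.range_eq_map, MonoidHom.range_eq_top.2 (QuotientGroup.mk'_surjective K)] at h1
      exact h1
    rw [iInf_lowerCentralSeries_eq_bot_of_mulEquiv e, Subgroup.mem_bot, QuotientGroup.mk'_apply,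
      QuotientGroup.eq_one_iff] at hq
    exact hq
  · exact le_iInf fun c => le_sup_left

/-- The quotient of `S_g` by the normal closure of a NORMAL subgroup is the quotient by the subgroup
itself: transport of `IsFreeOfRank` along `normalClosure K = K`. [folklore] -/
theorem isFreeOfRank_quotient_of_normalClosure {g n : ℕ} (K : Subgroup (SurfaceGroup g)) [K.Normal]
    (h : IsFreeOfRank (SurfaceGroup g ⧸ Subgroup.normalClosure (K : Set (SurfaceGroup g))) n) :
    IsFreeOfRank (SurfaceGroup g ⧸ K) n :=
  h.of_mulEquiv (QuotientGroup.quotientMulEquivOfEq (Subgroup.normalClosure_eq_self K))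

/-- **One automorphism solving every level solves exactly.** If `x(P)·γ_c = Q·γ_c` for all `c` and both
`S ⧸ P`, `S ⧸ Q` are free, then `x(P) = Q`. [folklore] -/
theorem map_eq_of_forall_map_sup_lowerCentralSeries_eq {g n n' : ℕ}
    (P Q : Subgroup (SurfaceGroup g)) [P.Normal] [Q.Normal]
    (hP : IsFreeOfRank (SurfaceGroup g ⧸ P) n) (hQ : IsFreeOfRank (SurfaceGroup g ⧸ Q) n')
    (x : SurfaceGroup g ≃* SurfaceGroup g)
    (h : ∀ c : ℕ, (P ⊔ (⊤ : Subgroup (SurfaceGroup g)).lowerCentralSeries c).map x.toMonoidHom =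
      Q ⊔ (⊤ : Subgroup (SurfaceGroup g)).lowerCentralSeries c) :
    P.map x.toMonoidHom = Q := by
  haveI : (P.map x.toMonoidHom).Normal := Subgroup.Normal.map inferInstance _ x.surjective
  -- `S ⧸ x(P) ≅ S ⧸ P` is free
  have hxP : IsFreeOfRank (SurfaceGroup g ⧸ P.map x.toMonoidHom) n := by
    refine hP.of_mulEquiv (QuotientGroup.congr P (P.map x.toMonoidHom) x rfl)
  have hlcs : ∀ c, ((⊤ : Subgroup (SurfaceGroup g)).lowerCentralSeries c).map x.toMonoidHom =
      (⊤ : Subgroup (SurfaceGroup g)).lowerCentralSeries c := by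
    intro c
    rw [Subgroup.map_lowerCentralSeries, ← MonoidHom.range_eq_map, MonoidHom.range_eq_top.2 x.surjective]
  calc P.map x.toMonoidHom
      = ⨅ c, (P.map x.toMonoidHom ⊔ (⊤ : Subgroup (SurfaceGroup g)).lowerCentralSeries c) :=
        (iInf_sup_lowerCentralSeries_eq_self _ hxP).symm
    _ = ⨅ c, (Q ⊔ (⊤ : Subgroup (SurfaceGroup g)).lowerCentralSeries c) := by
        refine iInf_congr fun c => ?_
        rw [← h c, Subgroup.map_sup, hlcs]
    _ = Q := iInf_sup_lowerCentralSeries_eq_self _ hQ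

/-- **A UNIFORM level solution closes the residual.** For a slot-normalised group trisection
`K = (N₀, N₁, K₂)` of any group (only `normal` and `free_quotient 2` are used) and one
`x ∈ Stab N₀ ∩ Stab N₁` with `x(N₂)·γ_c = K₂·γ_c` for EVERY `c`, the triples are isomorphic:
`TrisectionKernels.Iso N K`. (`N = s4Kernels.stabilizeIter m`; its slots are normal with free quotients
by the landed `WaldhausenPairs.Negative.stabilizeIter_isGroupTrisection`.)
[folklore] -/
theorem iso_of_uniform_levelSolution {m k : ℕ} {Γ : Type} [Group Γ]
    (K : TrisectionKernels (3 + 3 * m)) (hK : IsGroupTrisection (3 + 3 * m) k Γ K)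
    (h0 : K 0 = s4Kernels.stabilizeIter m 0) (h1 : K 1 = s4Kernels.stabilizeIter m 1)
    (x : SurfaceGroup (3 + 3 * m) ≃* SurfaceGroup (3 + 3 * m))
    (hx0 : (s4Kernels.stabilizeIter m 0).map x.toMonoidHom = s4Kernels.stabilizeIter m 0)
    (hx1 : (s4Kernels.stabilizeIter m 1).map x.toMonoidHom = s4Kernels.stabilizeIter m 1)
    (hx2 : ∀ c : ℕ, (s4Kernels.stabilizeIter m 2 ⊔
        (⊤ : Subgroup (SurfaceGroup (3 + 3 * m))).lowerCentralSeries c).map x.toMonoidHom =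
      K 2 ⊔ (⊤ : Subgroup (SurfaceGroup (3 + 3 * m))).lowerCentralSeries c) :
    TrisectionKernels.Iso (s4Kernels.stabilizeIter m) K := by
  -- the standard triple is a group trisection of the trivial group
  have hN : IsGroupTrisection (3 + 3 * m) (m + 1) (PUnit : Type) (s4Kernels.stabilizeIter m) :=
    Summit.SmoothPoincare4.SmoothPoincare4.Theorems.WaldhausenPairs.Negative.stabilizeIter_isGroupTrisection m
  haveI : ∀ i, (K i).Normal := hK.normal
  haveI : ∀ i, (s4Kernels.stabilizeIter m i).Normal := hN.normal
  have hfK : IsFreeOfRank (SurfaceGroup (3 + 3 * m) ⧸ K 2) (3 + 3 * m) :=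
    isFreeOfRank_quotient_of_normalClosure _ (hK.free_quotient 2)
  have hfN : IsFreeOfRank (SurfaceGroup (3 + 3 * m) ⧸ s4Kernels.stabilizeIter m 2) (3 + 3 * m) :=
    isFreeOfRank_quotient_of_normalClosure _ (hN.free_quotient 2)
  have hx2' : (s4Kernels.stabilizeIter m 2).map x.toMonoidHom = K 2 :=
    map_eq_of_forall_map_sup_lowerCentralSeries_eq _ _ hfN hfK x hx2
  refine ⟨x, fun i => ?_⟩
  fin_cases i
  · exact hx0.trans h0.symm
  · exact hx1.trans h1.symm
  · exact hx2'

/-- **Level solutions descend**: a level-`(c+1)` solution is a level-`c` solution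
(`γ_{c+1} ≤ γ_c`), so the solution sets form a decreasing tower. [folklore] -/
theorem levelSolution_mono {g : ℕ} (P Q : Subgroup (SurfaceGroup g)) (x : SurfaceGroup g ≃* SurfaceGroup g)
    (c : ℕ)
    (h : (P ⊔ (⊤ : Subgroup (SurfaceGroup g)).lowerCentralSeries (c + 1)).map x.toMonoidHom =
      Q ⊔ (⊤ : Subgroup (SurfaceGroup g)).lowerCentralSeries (c + 1)) :
    (P ⊔ (⊤ : Subgroup (SurfaceGroup g)).lowerCentralSeries c).map x.toMonoidHom =
      Q ⊔ (⊤ : Subgroup (SurfaceGroup g)).lowerCentralSeries c := by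
  have hle : (⊤ : Subgroup (SurfaceGroup g)).lowerCentralSeries (c + 1) ≤
      (⊤ : Subgroup (SurfaceGroup g)).lowerCentralSeries c :=
    Subgroup.lowerCentralSeries_antitone ⊤ (Nat.le_succ c)
  have hlcs : ∀ d, ((⊤ : Subgroup (SurfaceGroup g)).lowerCentralSeries d).map x.toMonoidHom =
      (⊤ : Subgroup (SurfaceGroup g)).lowerCentralSeries d := by
    intro d
    rw [Subgroup.map_lowerCentralSeries, ← MonoidHom.range_eq_map, MonoidHom.range_eq_top.2 x.surjective]
  have e1 : P ⊔ (⊤ : Subgroup (SurfaceGroup g)).lowerCentralSeries c =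
      (P ⊔ (⊤ : Subgroup (SurfaceGroup g)).lowerCentralSeries (c + 1)) ⊔
        (⊤ : Subgroup (SurfaceGroup g)).lowerCentralSeries c := by
    rw [sup_assoc, sup_eq_right.2 hle]
  have e2 : Q ⊔ (⊤ : Subgroup (SurfaceGroup g)).lowerCentralSeries c =
      (Q ⊔ (⊤ : Subgroup (SurfaceGroup g)).lowerCentralSeries (c + 1)) ⊔
        (⊤ : Subgroup (SurfaceGroup g)).lowerCentralSeries c := by
    rw [sup_assoc, sup_eq_right.2 hle]
  rw [e1, Subgroup.map_sup, h, hlcs, ← e2]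

/-- REGISTERED SUB-GOAL `helper_johnsonClosedGateUniform` of stub `stub_johnsonClosedGate` (line
`nilpotent-genus-class`): the residual with a UNIFORM level solution — one Goeritz element solving every
nilpotent level — holds; what remains of `stub_johnsonClosedGate` is exactly the passage from level-wise
to uniform solutions. [folklore] -/
theorem helper_johnsonClosedGateUniform :
    ∀ (m : ℕ) (K : TrisectionKernels (3 + 3 * m)),
      IsGroupTrisection (3 + 3 * m) (m + 1) (PUnit : Type) K →
      K 0 = s4Kernels.stabilizeIter m 0 → K 1 = s4Kernels.stabilizeIter m 1 →
      ∀ x : SurfaceGroup (3 + 3 * m) ≃* SurfaceGroup (3 + 3 * m),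
        (s4Kernels.stabilizeIter m 0).map x.toMonoidHom = s4Kernels.stabilizeIter m 0 →
        (s4Kernels.stabilizeIter m 1).map x.toMonoidHom = s4Kernels.stabilizeIter m 1 →
        (∀ c : ℕ, (s4Kernels.stabilizeIter m 2 ⊔
            (⊤ : Subgroup (SurfaceGroup (3 + 3 * m))).lowerCentralSeries c).map x.toMonoidHom =
          K 2 ⊔ (⊤ : Subgroup (SurfaceGroup (3 + 3 * m))).lowerCentralSeries c) →
        TrisectionKernels.Iso (s4Kernels.stabilizeIter m) K :=
  fun _ K hK h0 h1 x hx0 hx1 hx2 => iso_of_uniform_levelSolution K hK h0 h1 x hx0 hx1 hx2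

end Summit.SmoothPoincare4.SmoothPoincare4.Theorems.ShadowApproximation.NilpotentGenusClass

end
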